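import Summits.Ventures.YMGap.Census.CubeMerge
import Summits.Ventures.LatticeQCDFlow.Scoring.SU2PlaquetteCharacterSeries
import HarnessLib

/-!
# Venture YMGap, track (b) — the character expansion of POWERS of the plaquette function:
# Clebsch–Gordan linearisation, `f_c^ζ = F̂₀ · f_ĉ`, and Tomboulis's `F̂_j ≥ 0` (2.21)–(2.22) for every integer `ζ`

HONEST FRAMING: venture file of the cell `pub-ymgap` (QuantumFields programme), track (b); one-plaquette character
calculus for the potential-moving decimation of E. T. Tomboulis, arXiv:0707.2179 §2.1.  Nothing here concerns (5.15),
limits, confinement or a mass gap.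

Tomboulis's decimation `a → b a` raises `f(U) = 1 + Σ_{j≠0} d_j c_j χ_j(U)` to the integer power `ζ = b^{d-2}` on the
receiving plaquettes ((2.17), (RG5)) and re-expands `f^ζ = Σ_j d_j F̂_j χ_j = F̂₀ f(·;{ĉ_j})`, `F̂_j = ∫ f^ζ χ_j/d_j dU`,
`ĉ_j = F̂_j/F̂₀` ((2.21)–(2.22); tree: `Tomboulis2007.mkFhat`, `mkCoeff`).  Proved here for EVERY `ζ ∈ ℕ` and cut-off `J`:
* `chebyshevU_natCast_mul` — the Clebsch–Gordan series of `SU(2)` as the Chebyshev linearisation formula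
  `U_m · U_n = Σ_{k=0}^{m} U_{n-m+2k}` (`m ∈ ℕ`, `n ∈ ℤ`; two-step induction on `m` from Mathlib's three-term recurrence);
  `charR_mul_charR`, `charR_mul_eq_sum_cgMult` (`χ_i χ_j = Σ_n N_{ij}^n χ_n`, `N_{ij}^n = cgMult i j n ∈ {0,1}`, `n ≤ i + j`).
* `charSum_mul` — products of character sums are character sums (`mulCoef`, cut-offs add), coefficients `≥ 0` stay `≥ 0`
  (`mulCoef_nonneg`) and the trivial coefficient of a product dominates the product of the trivial coefficients
  (`mul_zero_le_mulCoef_zero`).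
* `fR_pow_eq_charSum` — `f_c(r)^ζ = Σ_{n ≤ ζJ} powCoef_n χ_n(r)`; `powCoef_nonneg`, `one_le_powCoef_zero`.
* **`mkFhat_eq`** — `F̂_j = powCoef_{2j}/d_j` for `2j ≤ ζJ` and `0` beyond (Haar orthonormality of the characters,
  `LatticeQCDFlow.Scoring.integral_su2Character_mul_su2Character`); hence **`mkFhat_nonneg`** (Tomboulis (2.22): "for
  integer `ζ` positivity of the coefficients is preserved"), `one_le_mkFhat_zero`, `mkFhat_eq_zero_of_lt` (cut-off `ζJ`).
* **`fR_pow_eq_mkFhat_mul_fR`** — `f_c^ζ = F̂₀ · f_ĉ` with `ĉ_j = F̂_j/F̂₀` and cut-off `ζJ` ((RG1)/(2.18) on one plaquette);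
  `mkCoeff_one_eq_pow` — at `r = 1` the decimated coefficient is the natural power `ĉ_j^{b²}` ((2.19)).
* `mkFhat_le_mkFhat_zero`, `hatCoeff_le_one`, **`coeffAdmissible_hatCoeff_pow`** — on the positivity domain `f_c ≥ 0`
  also `F̂_j ≤ F̂₀`, i.e. `0 ≤ ĉ_j ≤ 1` (Tomboulis (2.21) "`ĉ_j(n) ≤ 1`"; here from `|χ_j| ≤ d_j` and `f^ζ ≥ 0`), so the
  decimated coefficients `ĉ_j^{b²}` are again admissible.

References: E. T. Tomboulis, arXiv:0707.2179 §2.1 eqs. (2.17)–(2.22) [cite: Tomboulis2007Confinement, §2.1 (2.17)–(2.22)];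
N. Ja. Vilenkin, *Special functions and the theory of group representations*, AMS 1968, Ch. III §8 (Clebsch–Gordan series of
`SU(2)`) [folklore].
-/

noncomputable section

open MeasureTheory Finset Real Function Polynomial Polynomial.Chebyshev
open scoped BigOperators
open Literature.MathematicalPhysics.QuantumLattice
open Literature.MathematicalPhysics.QuantumFieldTheory
open Literature.MathematicalPhysics.QuantumFieldTheory.Tomboulis2007
open Literature.MathematicalPhysics.QuantumFieldTheory.WilsonRP
open Summit.Ventures.LatticeQCDFlow.Exactness
open Summit.Ventures.LatticeQCDFlow.Scoring

namespace Summit.Ventures.YMGap.Census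

/-! ### Chebyshev linearisation (the Clebsch–Gordan series of `SU(2)`) -/

section Chebyshev

variable (R : Type*) [CommRing R]

/-- `2X · U_j = U_{j+1} + U_{j-1}` (the three-term recurrence, `j ∈ ℤ`). -/
theorem two_X_mul_chebyshevU (j : ℤ) : 2 * X * U R j = U R (j + 1) + U R (j - 1) := by
  have h := U_add_one R j
  linear_combination -h

/-- **Chebyshev linearisation / Clebsch–Gordan series**: `U_m · U_n = Σ_{k=0}^{m} U_{n-m+2k}` for `m ∈ ℕ`, `n ∈ ℤ`. -/
theorem chebyshevU_natCast_mul (m : ℕ) :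
    ∀ n : ℤ, U R (m : ℤ) * U R n = ∑ k ∈ Finset.range (m + 1), U R (n - m + 2 * k) := by
  induction m using Nat.twoStepInduction with
  | zero =>
    intro n
    simp
  | one =>
    intro n
    rw [Finset.sum_range_succ, Finset.sum_range_one]
    push_cast
    rw [U_one, two_X_mul_chebyshevU, add_zero, show n - 1 + 2 = n + 1 by ring, add_comm]
  | more m ih0 ih1 =>
    intro n
    have hrec : U R ((m + 2 : ℕ) : ℤ) = 2 * X * U R ((m + 1 : ℕ) : ℤ) - U R (m : ℤ) := by
      have := U_add_two R (m : ℤ)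
      push_cast
      exact this
    rw [hrec, sub_mul, mul_assoc, ih1 n, ih0 n, Finset.mul_sum]
    simp_rw [two_X_mul_chebyshevU]
    rw [Finset.sum_add_distrib]
    -- `Σ_{k<m+2} U(n-(m+1)+2k+1) - Σ_{k<m+1} U(n-m+2k) = U(n+m+2)`
    have hA : ∑ k ∈ Finset.range (m + 2), U R (n - ((m + 1 : ℕ) : ℤ) + 2 * k + 1) =
        ∑ k ∈ Finset.range (m + 1), U R (n - (m : ℤ) + 2 * k) + U R (n + m + 2) := by
      rw [Finset.sum_range_succ]
      congr 1
      · refine Finset.sum_congr rfl fun k _ => ?_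
        congr 1
        push_cast
        ring
      · congr 1
        push_cast
        ring
    have hB : ∑ k ∈ Finset.range (m + 2), U R (n - ((m + 1 : ℕ) : ℤ) + 2 * k - 1) =
        ∑ k ∈ Finset.range (m + 2), U R (n - ((m + 2 : ℕ) : ℤ) + 2 * k) := by
      refine Finset.sum_congr rfl fun k _ => ?_
      congr 1
      push_cast
      ring
    rw [hA, hB, Finset.sum_range_succ (fun k => U R (n - ((m + 2 : ℕ) : ℤ) + 2 * k)) (m + 2)]
    have hlast : U R (n - ((m + 2 : ℕ) : ℤ) + 2 * ((m + 2 : ℕ) : ℤ)) = U R (n + m + 2) := by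
      congr 1
      push_cast
      ring
    rw [hlast]
    ring

end Chebyshev

/-! ### Products of characters `χ_n(r) = U_n(r/2)` -/

/-- `χ_i χ_j = Σ_{k=0}^{i} χ_{j-i+2k}` for `i ≤ j`. -/
theorem charR_mul_charR {i j : ℕ} (hij : i ≤ j) (r : ℝ) :
    charR i r * charR j r = ∑ k ∈ Finset.range (i + 1), charR (j - i + 2 * k) r := by
  unfold charR
  rw [← Polynomial.eval_mul, chebyshevU_natCast_mul, Polynomial.eval_finsetSum]
  refine Finset.sum_congr rfl fun k _ => ?_
  congr 2
  push_cast [Nat.cast_sub hij]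
  ring

/-- The Clebsch–Gordan multiplicity of `χ_n` in `χ_i χ_j` (`0` or `1`), as a real number:
`#{k ≤ min(i,j) : max - min + 2k = n}`. -/
def cgMult (i j n : ℕ) : ℝ :=
  ∑ k ∈ Finset.range (min i j + 1), if max i j - min i j + 2 * k = n then 1 else 0

/-- `cgMult i j n ≥ 0`. -/
theorem cgMult_nonneg (i j n : ℕ) : 0 ≤ cgMult i j n :=
  Finset.sum_nonneg fun k _ => by split_ifs <;> norm_num

/-- `cgMult i i 0 = 1` (the trivial representation occurs once in `χ_i χ_i`). -/
theorem cgMult_self_zero (i : ℕ) : cgMult i i 0 = 1 := by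
  unfold cgMult
  rw [min_self, max_self, Nat.sub_self, Finset.sum_eq_single 0 (fun k _ hk => by rw [if_neg]; omega)
    (fun h => absurd (Finset.mem_range.2 (Nat.succ_pos i)) h)]
  simp

/-- **`χ_i χ_j = Σ_{n ≤ N} N_{ij}^n χ_n`** for any `N ≥ i + j`. -/
theorem charR_mul_eq_sum_cgMult (i j N : ℕ) (hN : i + j ≤ N) (r : ℝ) :
    charR i r * charR j r = ∑ n ∈ Finset.range (N + 1), cgMult i j n * charR n r := by
  -- reduce to `min ≤ max`
  have key : charR i r * charR j r =
      ∑ k ∈ Finset.range (min i j + 1), charR (max i j - min i j + 2 * k) r := by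
    rcases le_total i j with h | h
    · rw [min_eq_left h, max_eq_right h, charR_mul_charR h]
    · rw [min_eq_right h, max_eq_left h, mul_comm, charR_mul_charR h]
  rw [key]
  unfold cgMult
  simp_rw [Finset.sum_mul]
  rw [Finset.sum_comm]
  refine Finset.sum_congr rfl fun k hk => ?_
  simp_rw [ite_mul, one_mul, zero_mul]
  rw [Finset.sum_ite_eq]
  have hk' := Finset.mem_range.1 hk
  refine (if_pos (Finset.mem_range.2 ?_)).symm
  rcases le_total i j with h | h
  · rw [min_eq_left h, max_eq_right h] at *; omega
  · rw [min_eq_right h, max_eq_left h] at *; omega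

/-! ### Products of character sums -/

/-- The coefficients of the product of two character sums with cut-offs `A`, `B`:
`(a ⋆ b)_n = Σ_{i ≤ A} Σ_{j ≤ B} a_i b_j N_{ij}^n`. -/
def mulCoef (A B : ℕ) (a b : ℕ → ℝ) (n : ℕ) : ℝ :=
  ∑ i ∈ Finset.range (A + 1), ∑ j ∈ Finset.range (B + 1), a i * b j * cgMult i j n

/-- **Products of character sums are character sums** (cut-offs add). -/
theorem charSum_mul (A B : ℕ) (a b : ℕ → ℝ) (r : ℝ) :
    charSum A a r * charSum B b r = charSum (A + B) (mulCoef A B a b) r := by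
  unfold charSum mulCoef
  rw [Finset.sum_mul_sum]
  -- expand each `χ_i χ_j`
  have h1 : ∀ i ∈ Finset.range (A + 1), ∀ j ∈ Finset.range (B + 1),
      a i * charR i r * (b j * charR j r) =
        ∑ n ∈ Finset.range (A + B + 1), a i * b j * cgMult i j n * charR n r := by
    intro i hi j hj
    have hij : i + j ≤ A + B := by
      have := Finset.mem_range.1 hi; have := Finset.mem_range.1 hj; omega
    rw [show a i * charR i r * (b j * charR j r) = a i * b j * (charR i r * charR j r) by ring,
      charR_mul_eq_sum_cgMult i j (A + B) hij r, Finset.mul_sum]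
    refine Finset.sum_congr rfl fun n _ => ?_
    ring
  have h2 : ∑ i ∈ Finset.range (A + 1), ∑ j ∈ Finset.range (B + 1), a i * charR i r * (b j * charR j r) =
      ∑ i ∈ Finset.range (A + 1), ∑ j ∈ Finset.range (B + 1),
        ∑ n ∈ Finset.range (A + B + 1), a i * b j * cgMult i j n * charR n r :=
    Finset.sum_congr rfl (fun i hi => Finset.sum_congr rfl (fun j hj => h1 i hi j hj))
  rw [h2]
  have h3 : ∀ i ∈ Finset.range (A + 1),
      ∑ j ∈ Finset.range (B + 1), ∑ n ∈ Finset.range (A + B + 1), a i * b j * cgMult i j n * charR n r =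
      ∑ n ∈ Finset.range (A + B + 1), ∑ j ∈ Finset.range (B + 1), a i * b j * cgMult i j n * charR n r :=
    fun i _ => Finset.sum_comm
  rw [Finset.sum_congr rfl h3, Finset.sum_comm]
  refine Finset.sum_congr rfl fun n _ => ?_
  rw [Finset.sum_mul]
  refine Finset.sum_congr rfl fun i _ => ?_
  rw [Finset.sum_mul]

/-- Non-negative coefficients multiply to non-negative coefficients. -/
theorem mulCoef_nonneg {A B : ℕ} {a b : ℕ → ℝ} (ha : ∀ n, 0 ≤ a n) (hb : ∀ n, 0 ≤ b n) (n : ℕ) :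
    0 ≤ mulCoef A B a b n :=
  Finset.sum_nonneg fun i _ => Finset.sum_nonneg fun j _ =>
    mul_nonneg (mul_nonneg (ha i) (hb j)) (cgMult_nonneg i j n)

/-- The trivial coefficient of a product of non-negative character sums dominates the product of the trivial
coefficients: `a_0 b_0 ≤ (a ⋆ b)_0`. -/
theorem mul_zero_le_mulCoef_zero {A B : ℕ} {a b : ℕ → ℝ} (ha : ∀ n, 0 ≤ a n) (hb : ∀ n, 0 ≤ b n) :
    a 0 * b 0 ≤ mulCoef A B a b 0 := by
  unfold mulCoef
  have hterm : ∀ i j, 0 ≤ a i * b j * cgMult i j 0 := fun i j =>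
    mul_nonneg (mul_nonneg (ha i) (hb j)) (cgMult_nonneg i j 0)
  calc a 0 * b 0 = a 0 * b 0 * cgMult 0 0 0 := by rw [cgMult_self_zero, mul_one]
    _ ≤ ∑ j ∈ Finset.range (B + 1), a 0 * b j * cgMult 0 j 0 :=
        Finset.single_le_sum (f := fun j => a 0 * b j * cgMult 0 j 0) (fun j _ => hterm 0 j)
          (Finset.mem_range.2 (Nat.succ_pos B))
    _ ≤ ∑ i ∈ Finset.range (A + 1), ∑ j ∈ Finset.range (B + 1), a i * b j * cgMult i j 0 :=
        Finset.single_le_sum (f := fun i => ∑ j ∈ Finset.range (B + 1), a i * b j * cgMult i j 0)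
          (fun i _ => Finset.sum_nonneg fun j _ => hterm i j) (Finset.mem_range.2 (Nat.succ_pos A))

/-! ### Powers of the plaquette function -/

/-- The character coefficients of `f_c^k` (cut-off `kJ`): `powCoef J c 0 = δ_0`, `powCoef J c (k+1) = powCoef J c k ⋆ stdCoef c`. -/
def powCoef (J : ℕ) (c : ℕ → ℝ) : ℕ → ℕ → ℝ
  | 0 => fun n => if n = 0 then 1 else 0
  | k + 1 => mulCoef (k * J) J (powCoef J c k) (stdCoef c)

/-- `charSum 0 δ_0 = 1`. -/
theorem charSum_zero_delta (r : ℝ) : charSum 0 (fun n => if n = 0 then (1 : ℝ) else 0) r = 1 := by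
  unfold charSum
  simp [charR_zero]

/-- **`f_c(r)^k = Σ_{n ≤ kJ} powCoef_n χ_n(r)`.** -/
theorem fR_pow_eq_charSum (J : ℕ) (c : ℕ → ℝ) (r : ℝ) (k : ℕ) :
    fR J c r ^ k = charSum (k * J) (powCoef J c k) r := by
  induction k with
  | zero => rw [pow_zero, Nat.zero_mul]; exact (charSum_zero_delta r).symm
  | succ k ih => rw [pow_succ, ih, ← charSum_stdCoef, charSum_mul, Nat.succ_mul]; rfl

/-- The power coefficients are non-negative when `c_j ≥ 0` (`j ≠ 0`). -/
theorem powCoef_nonneg {J : ℕ} {c : ℕ → ℝ} (hc : ∀ n, 1 ≤ n → 0 ≤ c n) (k n : ℕ) : 0 ≤ powCoef J c k n := by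
  induction k generalizing n with
  | zero => simp only [powCoef]; split_ifs <;> norm_num
  | succ k ih => exact mulCoef_nonneg ih (stdCoef_nonneg hc) n

/-- The trivial coefficient of `f_c^k` is at least `1` when `c_j ≥ 0`. -/
theorem one_le_powCoef_zero {J : ℕ} {c : ℕ → ℝ} (hc : ∀ n, 1 ≤ n → 0 ≤ c n) (k : ℕ) : 1 ≤ powCoef J c k 0 := by
  induction k with
  | zero => simp [powCoef]
  | succ k ih =>
    calc (1 : ℝ) ≤ powCoef J c k 0 * stdCoef c 0 := by simp [stdCoef, ih]
      _ ≤ _ := mul_zero_le_mulCoef_zero (powCoef_nonneg hc k) (stdCoef_nonneg hc)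

/-! ### The decimation coefficients `F̂_j` for every integer `ζ` -/

/-- `f_c(U) = fR J c (Re tr U)` (definitional). -/
theorem plaqFn_eq_fR (J : ℕ) (c : ℕ → ℝ) (g : SU2) : plaqFn J c g = fR J c ((rhoFund g).trace.re) := rfl

/-- `χ_n(U) = U_n(a₀(U))` (definitional; cf. `TwoDimDecimation.su2Char_eq_eval_su2a0`). -/
private theorem su2Char_eq_eval (n : ℕ) (g : SU2) : su2Char n g = (U ℝ n).eval (su2a0 g) := rfl

/-- `χ_n(Re tr U) = U_n(a₀(U))` (definitional). -/
theorem charR_trace_eq_eval_su2a0 (n : ℕ) (g : SU2) : charR n ((rhoFund g).trace.re) = (U ℝ n).eval (su2a0 g) := rfl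

/-- `∫ (Σ_{m ≤ K} a_m χ_m) χ_n dHaar = a_n [n ≤ K]`. -/
theorem integral_charSum_mul_su2Char (K : ℕ) (a : ℕ → ℝ) (n : ℕ) :
    ∫ g, charSum K a ((rhoFund g).trace.re) * (U ℝ n).eval (su2a0 g) ∂(haarProbability SU2) =
      if n ≤ K then a n else 0 := by
  unfold charSum
  simp_rw [charR_trace_eq_eval_su2a0, Finset.sum_mul]
  have hχ : ∀ m : ℕ, Integrable (fun g : SU2 => a m * (U ℝ m).eval (su2a0 g) * (U ℝ n).eval (su2a0 g))
      (haarProbability SU2) := fun m =>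
    ((continuous_const.mul (continuous_su2Character_comp m continuous_id)).mul
      (continuous_su2Character_comp n continuous_id)).integrable_of_hasCompactSupport
      (HasCompactSupport.of_compactSpace _)
  rw [integral_finsetSum _ (fun m _ => hχ m)]
  simp_rw [mul_assoc, integral_const_mul, integral_su2Character_mul_su2Character, mul_ite, mul_one, mul_zero]
  rw [Finset.sum_ite_eq']
  by_cases h : n ≤ K
  · rw [if_pos (Finset.mem_range.2 (Nat.lt_succ_of_le h)), if_pos h]
  · rw [if_neg (fun hm => h (Nat.le_of_lt_succ (Finset.mem_range.1 hm))), if_neg h]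

/-- **`F̂_j` for every integer `ζ`**: `F̂_j = powCoef_{2j}/d_j` for `2j ≤ ζJ`, `0` beyond the cut-off. -/
theorem mkFhat_eq (J : ℕ) (c : ℕ → ℝ) (ζ n : ℕ) :
    mkFhat J c ζ n = if n ≤ ζ * J then powCoef J c ζ n / ((n : ℝ) + 1) else 0 := by
  unfold mkFhat
  simp_rw [plaqFn_eq_fR, fR_pow_eq_charSum, su2Char_eq_eval]
  have hpt : ∀ g : SU2, charSum (ζ * J) (powCoef J c ζ) ((rhoFund g).trace.re) * ((U ℝ n).eval (su2a0 g) / ((n : ℝ) + 1)) =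
      ((n : ℝ) + 1)⁻¹ * (charSum (ζ * J) (powCoef J c ζ) ((rhoFund g).trace.re) * (U ℝ n).eval (su2a0 g)) := by
    intro g; ring
  simp_rw [hpt]
  rw [integral_const_mul, integral_charSum_mul_su2Char]
  split_ifs <;> ring

/-- `F̂_j = 0` beyond the cut-off `2j > ζJ`. -/
theorem mkFhat_eq_zero_of_lt {J : ℕ} (c : ℕ → ℝ) {ζ n : ℕ} (h : ζ * J < n) : mkFhat J c ζ n = 0 := by
  rw [mkFhat_eq, if_neg (not_le.2 h)]

/-- **Tomboulis (2.22): for integer `ζ` the coefficients stay non-negative**, `F̂_j ≥ 0`, when `c_j ≥ 0`. -/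
theorem mkFhat_nonneg {J : ℕ} {c : ℕ → ℝ} (hc : ∀ n, 1 ≤ n → 0 ≤ c n) (ζ n : ℕ) : 0 ≤ mkFhat J c ζ n := by
  rw [mkFhat_eq]
  split_ifs
  · exact div_nonneg (powCoef_nonneg hc ζ n) (by positivity)
  · exact le_rfl

/-- `F̂_0 ≥ 1` when `c_j ≥ 0`. -/
theorem one_le_mkFhat_zero {J : ℕ} {c : ℕ → ℝ} (hc : ∀ n, 1 ≤ n → 0 ≤ c n) (ζ : ℕ) : 1 ≤ mkFhat J c ζ 0 := by
  rw [mkFhat_eq, if_pos (Nat.zero_le _)]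
  simpa using one_le_powCoef_zero hc ζ (J := J)

/-- `F̂_0 > 0` when `c_j ≥ 0`. -/
theorem mkFhat_zero_pos {J : ℕ} {c : ℕ → ℝ} (hc : ∀ n, 1 ≤ n → 0 ≤ c n) (ζ : ℕ) : 0 < mkFhat J c ζ 0 :=
  one_pos.trans_le (one_le_mkFhat_zero hc ζ)

/-- The normalised decimation coefficients `ĉ_j = F̂_j/F̂_0` (arXiv:0707.2179 (2.21)). -/
def hatCoeff (J : ℕ) (c : ℕ → ℝ) (ζ : ℕ) (n : ℕ) : ℝ := mkFhat J c ζ n / mkFhat J c ζ 0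

/-- `ĉ_j ≥ 0`. -/
theorem hatCoeff_nonneg {J : ℕ} {c : ℕ → ℝ} (hc : ∀ n, 1 ≤ n → 0 ≤ c n) (ζ n : ℕ) : 0 ≤ hatCoeff J c ζ n :=
  div_nonneg (mkFhat_nonneg hc ζ n) (mkFhat_nonneg hc ζ 0)

/-- **`f_c^ζ = F̂₀ · f_ĉ`** with cut-off `ζJ` (arXiv:0707.2179 (2.18)/(RG1) on a single plaquette). -/
theorem fR_pow_eq_mkFhat_mul_fR {J : ℕ} {c : ℕ → ℝ} (hc : ∀ n, 1 ≤ n → 0 ≤ c n) (ζ : ℕ) (r : ℝ) :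
    fR J c r ^ ζ = mkFhat J c ζ 0 * fR (ζ * J) (hatCoeff J c ζ) r := by
  rw [fR_pow_eq_charSum, ← charSum_stdCoef]
  unfold charSum
  rw [Finset.mul_sum]
  refine Finset.sum_congr rfl fun n hn => ?_
  have hnK : n ≤ ζ * J := Nat.le_of_lt_succ (Finset.mem_range.1 hn)
  have h0 : mkFhat J c ζ 0 ≠ 0 := (mkFhat_zero_pos hc ζ).ne'
  rw [← mul_assoc]
  congr 1
  unfold stdCoef hatCoeff
  split_ifs with hn0
  · subst hn0
    rw [mkFhat_eq, if_pos (Nat.zero_le _)]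
    simp
  · rw [mkFhat_eq J c ζ n, if_pos hnK]
    field_simp

/-- `f_c(U)^ζ = F̂₀ · f_ĉ(U)` on the group. -/
theorem plaqFn_pow_eq {J : ℕ} {c : ℕ → ℝ} (hc : ∀ n, 1 ≤ n → 0 ≤ c n) (ζ : ℕ) (g : SU2) :
    plaqFn J c g ^ ζ = mkFhat J c ζ 0 * plaqFn (ζ * J) (hatCoeff J c ζ) g := by
  rw [plaqFn_eq_fR, plaqFn_eq_fR, fR_pow_eq_mkFhat_mul_fR hc]

/-- **At `r = 1` the decimated coefficient is the natural power `ĉ_j^{b²}`** (arXiv:0707.2179 (2.19)). -/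
theorem mkCoeff_one_eq_pow (J : ℕ) (c : ℕ → ℝ) (ζ b n : ℕ) :
    mkCoeff J c ζ b 1 n = hatCoeff J c ζ n ^ (b ^ 2) := by
  unfold mkCoeff hatCoeff
  rw [mul_one, show ((b : ℝ) ^ 2) = ((b ^ 2 : ℕ) : ℝ) by push_cast; ring, Real.rpow_natCast]

/-- `F_0 = F̂_0^{b²}` (definitional) and `F_0 ≥ 1`. -/
theorem one_le_mkF0 {J : ℕ} {c : ℕ → ℝ} (hc : ∀ n, 1 ≤ n → 0 ≤ c n) (ζ b : ℕ) : 1 ≤ mkF0 J c ζ b :=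
  one_le_pow₀ (one_le_mkFhat_zero hc ζ)

/-! ### On the positivity domain `f_c ≥ 0`: `ĉ_j ≤ 1` -/

/-- `F̂_j ≤ F̂_0` when `f_c ≥ 0` on the group (from `|χ_j/d_j| ≤ 1` and `f^ζ ≥ 0`). -/
theorem mkFhat_le_mkFhat_zero {J : ℕ} {c : ℕ → ℝ} (hf : ∀ g : SU2, 0 ≤ plaqFn J c g) (ζ n : ℕ) :
    mkFhat J c ζ n ≤ mkFhat J c ζ 0 := by
  unfold mkFhat
  have hcf : Continuous fun g : SU2 => plaqFn J c g ^ ζ := by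
    have h : Continuous fun g : SU2 => plaqFn J c g := by
      unfold plaqFn
      simp_rw [su2Char_eq_eval]
      exact continuous_const.add (continuous_finsetSum _ fun m _ =>
        continuous_const.mul (continuous_su2Character_comp m continuous_id))
    exact h.pow ζ
  have hint : ∀ m : ℕ, Integrable (fun g : SU2 => plaqFn J c g ^ ζ * (su2Char m g / ((m : ℝ) + 1)))
      (haarProbability SU2) := fun m =>
    (hcf.mul ((continuous_su2Character_comp m continuous_id).div_const _)).integrable_of_hasCompactSupport
      (HasCompactSupport.of_compactSpace _)
  refine integral_mono (hint n) (hint 0) fun g => ?_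
  have hfz : 0 ≤ plaqFn J c g ^ ζ := pow_nonneg (hf g) ζ
  have h0 : su2Char 0 g / (((0 : ℕ) : ℝ) + 1) = 1 := by simp [su2Char_eq_eval]
  dsimp only
  rw [h0, mul_one]
  refine mul_le_of_le_one_right hfz ?_
  rw [div_le_one (by positivity), su2Char_eq_eval]
  exact (le_abs_self _).trans (abs_chebyshevU_eval_le n (abs_su2a0_le_one g))

/-- **`ĉ_j ≤ 1` on the positivity domain** (arXiv:0707.2179 (2.21)). -/
theorem hatCoeff_le_one {J : ℕ} {c : ℕ → ℝ} (hc : ∀ n, 1 ≤ n → 0 ≤ c n) (hf : ∀ g : SU2, 0 ≤ plaqFn J c g)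
    (ζ n : ℕ) : hatCoeff J c ζ n ≤ 1 :=
  (div_le_one (mkFhat_zero_pos hc ζ)).2 (mkFhat_le_mkFhat_zero hf ζ n)

/-- **The decimated coefficients `ĉ_j^{b²}` are admissible** (`0 ≤ · ≤ 1`) on the positivity domain. -/
theorem coeffAdmissible_hatCoeff_pow {J : ℕ} {c : ℕ → ℝ} (hc : ∀ n, 1 ≤ n → 0 ≤ c n)
    (hf : ∀ g : SU2, 0 ≤ plaqFn J c g) (ζ k : ℕ) : CoeffAdmissible fun n => hatCoeff J c ζ n ^ k :=
  fun n _ => ⟨pow_nonneg (hatCoeff_nonneg hc ζ n) k, pow_le_one₀ (hatCoeff_nonneg hc ζ n) (hatCoeff_le_one hc hf ζ n)⟩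

/-- In particular `c ↦ mkCoeff J c ζ b 1` maps the positivity domain into admissible coefficients. -/
theorem coeffAdmissible_mkCoeff_one_of_nonneg {J : ℕ} {c : ℕ → ℝ} (hc : ∀ n, 1 ≤ n → 0 ≤ c n)
    (hf : ∀ g : SU2, 0 ≤ plaqFn J c g) (ζ b : ℕ) : CoeffAdmissible (mkCoeff J c ζ b 1) := by
  have h : mkCoeff J c ζ b 1 = fun n => hatCoeff J c ζ n ^ (b ^ 2) := funext fun n => mkCoeff_one_eq_pow J c ζ b n
  rw [h]
  exact coeffAdmissible_hatCoeff_pow hc hf ζ (b ^ 2)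

end Summit.Ventures.YMGap.Census

end
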